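import Summits.CriticalPhenomena.PercolationContinuityZ3.Theorems.PercNearOneGluingNoHeavyLowerTailSahiCTCLadderSqfreeT
import HarnessLib

/-!
# `NoHeavyLowerTail` (crux stmt-CriticalPhenomena-4575), P3 lane: the charge side of the ladder `(L_t)` at every level and the TOP doubled row

Support file (seat `prim-l12-p3`, gen 26; `--supports stmt-CriticalPhenomena-4575`).  Continues `…SahiCTCLadderPrep` (t = 2) and `…SahiCTCLadderSqfreeT`.
For `L_t(𝒳,𝒵) = e_t·(Π·Y − X·Z) − Θ_{t−1}·e_{≥t}·GF(W_t)` (memo g24 §5.5, g26):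
* `coeff_ee_mul` — peeling `e_t`; `coeff_thetaT_mul_atLeastT_eq` / `_eq_cH` / `_eq_zero` — the charge factor `γ_t(n) := [n](Θ_{t−1}·e_{≥t})`
  as a count and in closed form `cH (t − #dbl n) #(sgl n)`; `coeff_chargeT_eq_sum` — `[m](Θ_{t−1}e_{≥t}GF(W)) = Σ_{w ∈ W, 1_w ≤ m} γ_t(m − 1_w)`;
* `coeff_chargeT_top` — at a profile `m ≤ 2` with exactly `2t−1` doubled points the charge is `#{w ∈ W_t : w ⊆ dbl m}`;
* `card_le_card_shadowT` — local LYM in `2^D`, `#D = 2t−1`: a family of `t`-subsets of `D` has at least as many `(t−1)`-subsets below it;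
* `coeff_ladder_topRow_nonneg` — **`[m] L_t ≥ 0` whenever `m ≤ 2` pointwise and `#(dbl m) = 2t−1`**, every `t ≥ 1`, every pair of `t`-live up-sets
  (LOOP on the cubes `E ⊆ dbl m`, `#E = t`, + the shadow bound);  with `…SqfreeT` (no doubled point) and the vanishing of the charge for `#dbl ≥ 2t`
  (`coeff_ladder_manyDoubled_nonneg`) these are the two extreme rows of `(L_t)` (memo g26 §4.4).
Nothing is asserted about the crux.
-/

namespace Summit.CriticalPhenomena.PercolationContinuityZ3.Theorems.SahiCTCForms

open Finset MvPolynomial SahiCTCGenFun SahiCTCWeightedLYM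

variable {α : Type*} [DecidableEq α] [Fintype α]

section ChargeT
variable {𝒳 𝒵 : Finset (Finset α)}

omit [DecidableEq α] in
/-- **Peeling `e_t`**: `coeff m (e_t·P) = Σ_{E : #E = t, 1_E ≤ m} coeff (m − 1_E) P`. [this work] -/
theorem coeff_ee_mul (t : ℕ) (P : MvPolynomial α ℤ) (m : α →₀ ℕ) :
    (ee t * P).coeff m = ∑ E ∈ (bySize (· = t) : Finset (Finset α)).filter (fun E => ind E ≤ m), P.coeff (m - ind E) := by
  unfold ee; exact coeff_gf_mul _ P m

/-- `γ_t(n) := coeff n (Θ_{t−1} · e_{≥t})` as a count, for `n ≤ 2`. [this work] -/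
theorem coeff_thetaT_mul_atLeastT_eq (t : ℕ) {n : α →₀ ℕ} (hn : ∀ i, n i ≤ 2) :
    (gf (bySize (· ≤ t - 1) : Finset (Finset α)) * gf (bySize (t ≤ ·) : Finset (Finset α))).coeff n =
      #((sgl n).powerset.filter fun U => #(dbl n) + #U ≤ t - 1 ∧ t ≤ #(dbl n) + #(sgl n \ U)) := by
  rw [coeff_gf_mul_gf_eq_card_tr _ _ hn]
  congr 2
  have hdisj : ∀ U ⊆ sgl n, Disjoint (dbl n) U := fun U hU => Disjoint.mono_right hU (disjoint_dbl_sgl n)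
  ext U
  simp only [mem_filter, mem_tr, bySize, mem_powerset, subset_univ, true_and]
  constructor
  · rintro ⟨⟨hUs, h1⟩, _, h2⟩
    rw [card_union_of_disjoint (hdisj U hUs)] at h1
    rw [card_union_of_disjoint (hdisj _ sdiff_subset)] at h2
    exact ⟨hUs, h1, h2⟩
  · rintro ⟨hUs, h1, h2⟩
    refine ⟨⟨hUs, ?_⟩, sdiff_subset, ?_⟩
    · rw [card_union_of_disjoint (hdisj U hUs)]; exact h1
    · rw [card_union_of_disjoint (hdisj _ sdiff_subset)]; exact h2

/-- **Closed form of the charge factor** (`t ≥ 1`): `γ_t(n) = cH (t − #dbl n) #(sgl n)` for `n ≤ 2` (`cH r f = κ(H_r, H_r)` on `f`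
points; `0` when `#dbl n ≥ t`). [this work] -/
theorem coeff_thetaT_mul_atLeastT_eq_cH {t : ℕ} (ht : 1 ≤ t) {n : α →₀ ℕ} (hn : ∀ i, n i ≤ 2) :
    (gf (bySize (· ≤ t - 1) : Finset (Finset α)) * gf (bySize (t ≤ ·) : Finset (Finset α))).coeff n =
      cH (t - #(dbl n)) #(sgl n) := by
  rw [coeff_thetaT_mul_atLeastT_eq t hn]
  by_cases hb : #(dbl n) < t
  · rw [← card_filter_small_cosmall (t - #(dbl n)) (by omega) (sgl n)]
    norm_cast
    congr 1; ext U; simp only [mem_filter, mem_powerset]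
    constructor
    · rintro ⟨hU, h1, h2⟩; exact ⟨hU, by omega, by omega⟩
    · rintro ⟨hU, h1, h2⟩; exact ⟨hU, by omega, by omega⟩
  · have h0 : t - #(dbl n) = 0 := by omega
    have hemp : ((sgl n).powerset.filter fun U => #(dbl n) + #U ≤ t - 1 ∧ t ≤ #(dbl n) + #(sgl n \ U)) = ∅ :=
      filter_eq_empty_iff.2 fun U _ h => by obtain ⟨h1, _⟩ := h; omega
    rw [h0, hemp, card_empty]
    unfold cH; simp

/-- `γ_t(n) = 0` when some exponent of `n` is `≥ 3`. [this work] -/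
theorem coeff_thetaT_mul_atLeastT_eq_zero (t : ℕ) {n : α →₀ ℕ} (hn : ¬ ∀ i, n i ≤ 2) :
    (gf (bySize (· ≤ t - 1) : Finset (Finset α)) * gf (bySize (t ≤ ·) : Finset (Finset α))).coeff n = 0 := by
  rw [coeff_gf_mul_gf, filter_prod_eq_empty _ _ n hn, card_empty, Nat.cast_zero]

/-- `γ_t ≥ 0`. [this work] -/
theorem coeff_thetaT_mul_atLeastT_nonneg (t : ℕ) (n : α →₀ ℕ) :
    0 ≤ (gf (bySize (· ≤ t - 1) : Finset (Finset α)) * gf (bySize (t ≤ ·) : Finset (Finset α))).coeff n :=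
  coeff_mul_nonneg (coeff_gf_nonneg _) (coeff_gf_nonneg _) n

omit [DecidableEq α] in
/-- **The charge side at level `t`**: `coeff m (Θ_{t−1}·e_{≥t}·GF(W)) = Σ_{w ∈ W, 1_w ≤ m} γ_t(m − 1_w)`. [this work] -/
theorem coeff_chargeT_eq_sum (t : ℕ) (W : Finset (Finset α)) (m : α →₀ ℕ) :
    (gf (bySize (· ≤ t - 1) : Finset (Finset α)) * gf (bySize (t ≤ ·) : Finset (Finset α)) * gf W).coeff m =
      ∑ w ∈ W.filter (fun w => ind w ≤ m),
        (gf (bySize (· ≤ t - 1) : Finset (Finset α)) * gf (bySize (t ≤ ·) : Finset (Finset α))).coeff (m - ind w) := by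
  rw [mul_comm, coeff_gf_mul]

/-- The surplus side dominates any partial sum of residual Harris coefficients: for `S ⊆ {E : #E = t, 1_E ≤ m}`,
`Σ_{E ∈ S} coeff (m − 1_E) H ≤ coeff m (e_t·H)`. [this work] -/
theorem sum_le_coeff_ee_mul_harris (h𝒳 : IsUpperSet (𝒳 : Set (Finset α))) (h𝒵 : IsUpperSet (𝒵 : Set (Finset α)))
    (t : ℕ) (m : α →₀ ℕ) {S : Finset (Finset α)} (hS : S ⊆ (bySize (· = t) : Finset (Finset α)).filter fun E => ind E ≤ m) :
    ∑ E ∈ S, (PiP * gf (𝒳 ∩ 𝒵) - gf 𝒳 * gf 𝒵).coeff (m - ind E) ≤ (ee t * (PiP * gf (𝒳 ∩ 𝒵) - gf 𝒳 * gf 𝒵)).coeff m := by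
  rw [coeff_ee_mul]
  exact sum_le_sum_of_subset_of_nonneg hS fun E _ _ => coeff_harrisForm_nonneg_kap h𝒳 h𝒵 _

end ChargeT

/-! ### The top doubled row `#(dbl m) = 2t − 1` and the empty rows `#(dbl m) ≥ 2t` -/

section TopRow
variable {𝒳 𝒵 : Finset (Finset α)}

omit [DecidableEq α] [Fintype α] in
/-- For `m ≤ 2` there are no tripled points. [this work] -/
theorem lev_three_eq_empty {m : α →₀ ℕ} (hm : ∀ i, m i ≤ 2) : lev m 3 = ∅ :=
  filter_eq_empty_iff.2 fun i _ h => by have := hm i; omega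

omit [Fintype α] in
/-- Residual doubled set for `m ≤ 2`: `dbl (m − 1_w) = dbl m ∖ w`. [this work] -/
theorem dbl_sub_ind_of_le_two {m : α →₀ ℕ} (hm : ∀ i, m i ≤ 2) (w : Finset α) : dbl (m - ind w) = dbl m \ w := by
  rw [dbl_sub_ind (fun i => (hm i).trans (by norm_num)), lev_three_eq_empty hm, empty_inter, empty_union, dbl_eq_lev]

omit [Fintype α] in
/-- Residual single set for `m ≤ 2`: `sgl (m − 1_w) = (dbl m ∩ w) ∪ (lev m 1 ∖ w)`. [this work] -/
theorem sgl_sub_ind_of_le_two {m : α →₀ ℕ} (hm : ∀ i, m i ≤ 2) (w : Finset α) :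
    sgl (m - ind w) = (dbl m ∩ w) ∪ (lev m 1 \ w) := by
  rw [sgl_sub_ind (fun i => (hm i).trans (by norm_num)) (by rw [lev_three_eq_empty hm]; exact empty_subset _), dbl_eq_lev]

omit [Fintype α] in
/-- The residual profile of `m ≤ 2` is again `≤ 2`. [this work] -/
theorem sub_ind_le_two_of_le_two {m : α →₀ ℕ} (hm : ∀ i, m i ≤ 2) (w : Finset α) : ∀ i, (m - ind w) i ≤ 2 :=
  (sub_ind_le_two_iff (fun i => (hm i).trans (by norm_num))).2 (by rw [lev_three_eq_empty hm]; exact empty_subset _)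

/-- **The charge factor in the doubled rows**: for `m ≤ 2` and a `t`-set `w`, `γ_t(m − 1_w) = 0` unless `#(dbl m ∖ w) ≤ t − 1`; at the top row
`#(dbl m) = 2t − 1` this means `w ⊆ dbl m`, and then `γ_t = 1`. [this work] -/
theorem coeff_chargeT_top {t : ℕ} (ht : 1 ≤ t) {m : α →₀ ℕ} (hm : ∀ i, m i ≤ 2) (hD : #(dbl m) = 2 * t - 1)
    (W : Finset (Finset α)) (hW : ∀ w ∈ W, #w = t) :
    (gf (bySize (· ≤ t - 1) : Finset (Finset α)) * gf (bySize (t ≤ ·) : Finset (Finset α)) * gf W).coeff m =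
      #(W.filter fun w => w ⊆ dbl m) := by
  rw [coeff_chargeT_eq_sum]
  have hval : ∀ w ∈ W.filter (fun w => ind w ≤ m),
      (gf (bySize (· ≤ t - 1) : Finset (Finset α)) * gf (bySize (t ≤ ·) : Finset (Finset α))).coeff (m - ind w) =
        if w ⊆ dbl m then 1 else 0 := fun w hw => by
    obtain ⟨hwW, _⟩ := mem_filter.1 hw
    have hwt := hW w hwW
    rw [coeff_thetaT_mul_atLeastT_eq_cH ht (sub_ind_le_two_of_le_two hm w), dbl_sub_ind_of_le_two hm, sgl_sub_ind_of_le_two hm]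
    have hsd : #(dbl m \ w) + #(dbl m ∩ w) = #(dbl m) := card_sdiff_add_card_inter (dbl m) w
    split_ifs with hsub
    · have hint : dbl m ∩ w = w := inter_eq_right.2 hsub
      rw [hint] at hsd ⊢
      have h1 : t - #(dbl m \ w) = 1 := by omega
      have hf : 1 ≤ #(w ∪ lev m 1 \ w) := by
        have := card_le_card (subset_union_left (s₁ := w) (s₂ := lev m 1 \ w)); omega
      rw [h1]; unfold cH
      rw [show min 1 (#(w ∪ lev m 1 \ w) + 1 - 1) = 1 from by omega]
      simp
    · have hlt : #(dbl m ∩ w) < t := by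
        by_contra hge
        have heq : dbl m ∩ w = w := eq_of_subset_of_card_le inter_subset_right (by rw [hwt]; omega)
        exact hsub (by rw [← heq]; exact inter_subset_left)
      have h0 : t - #(dbl m \ w) = 0 := by omega
      rw [h0]; unfold cH; simp
  rw [sum_congr rfl hval, sum_boole]
  norm_cast
  congr 1; ext w
  simp only [mem_filter, and_assoc]
  constructor
  · rintro ⟨hw, _, h⟩; exact ⟨hw, h⟩
  · rintro ⟨hw, h⟩
    exact ⟨hw, (SahiAllButC.ind_le_iff_subset_support _ _).2 (h.trans (dbl_subset_support m)), h⟩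

/-- The `(t−1)`-subsets of `D` lying under a common `t`-set inside `D` (the shadow of `W_t[D]`). [this work] -/
def shadowT (𝒳 𝒵 : Finset (Finset α)) (D : Finset α) (t : ℕ) : Finset (Finset α) :=
  (D.powersetCard (t - 1)).filter fun B => ∃ u ∈ D \ B, insert u B ∈ 𝒳 ∧ insert u B ∈ 𝒵

omit [Fintype α] in
/-- **Local LYM in `2^D` at the top row**: if `#D = 2t − 1` then a family of common `t`-subsets of `D` has at least as many `(t−1)`-subsets in its
shadow (`t` erasures each, at most `t` insertions each). [folklore] -/
theorem card_le_card_shadowT {t : ℕ} (ht : 1 ≤ t) {D : Finset α} (hD : #D = 2 * t - 1) :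
    #((((𝒳 ∩ 𝒵).filter fun S => #S = t).filter fun w => w ⊆ D)) ≤ #(shadowT 𝒳 𝒵 D t) := by
  set WD := ((𝒳 ∩ 𝒵).filter fun S => #S = t).filter fun w => w ⊆ D
  have key : #WD * t ≤ #(shadowT 𝒳 𝒵 D t) * t := by
    refine card_mul_le_card_mul (fun w B => B ⊆ w) (fun w hw => ?_) (fun B hB => ?_)
    · obtain ⟨hw', hwD⟩ := mem_filter.1 hw
      obtain ⟨hwXZ, hwt⟩ := mem_filter.1 hw'
      obtain ⟨hwX, hwZ⟩ := mem_inter.1 hwXZ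
      have himg : w.image (fun u => w.erase u) ⊆ (shadowT 𝒳 𝒵 D t).bipartiteAbove (fun w B => B ⊆ w) w := fun B hB => by
        obtain ⟨u, hu, rfl⟩ := mem_image.1 hB
        refine (mem_bipartiteAbove _).2 ⟨mem_filter.2 ⟨mem_powersetCard.2 ⟨(erase_subset u w).trans hwD, ?_⟩, u, ?_, ?_⟩, erase_subset u w⟩
        · rw [card_erase_of_mem hu, hwt]
        · exact mem_sdiff.2 ⟨hwD hu, notMem_erase u w⟩
        · rw [insert_erase hu]; exact ⟨hwX, hwZ⟩
      have := card_le_card himg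
      rwa [card_image_of_injOn (erase_injOn w), hwt] at this
    · obtain ⟨hB', _⟩ := mem_filter.1 hB
      obtain ⟨hBD, hBt⟩ := mem_powersetCard.1 hB'
      have hsub : WD.bipartiteBelow (fun w B => B ⊆ w) B ⊆ (D \ B).image fun u => insert u B := fun w hw => by
        obtain ⟨hwWD, hBw⟩ := (mem_bipartiteBelow _).1 hw
        obtain ⟨hw', hwD⟩ := mem_filter.1 hwWD
        have hwt := (mem_filter.1 hw').2
        have hc : #(w \ B) = 1 := by rw [card_sdiff_of_subset hBw]; omega
        obtain ⟨u, hu⟩ := card_eq_one.1 hc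
        refine mem_image.2 ⟨u, ?_, ?_⟩
        · have : u ∈ w \ B := by rw [hu]; exact mem_singleton_self u
          exact mem_sdiff.2 ⟨hwD (mem_sdiff.1 this).1, (mem_sdiff.1 this).2⟩
        · rw [← union_sdiff_of_subset hBw, hu, union_comm]; rfl
      have := (card_le_card hsub).trans card_image_le
      rw [card_sdiff_of_subset hBD, hD, hBt] at this
      have e : 2 * t - 1 - (t - 1) = t := by omega
      rwa [e] at this
  exact Nat.le_of_mul_le_mul_right key (by omega)

/-- **The top doubled row of `(L_t)`, every `t ≥ 1`**: if `m ≤ 2` pointwise and `m` has exactly `2t − 1` doubled points, then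
`[m] ( e_t·(Π·GF(𝒳∩𝒵) − GF(𝒳)GF(𝒵)) − Θ_{t−1}·e_{≥t}·GF((𝒳∩𝒵)_t) ) ≥ 0` for `t`-live up-sets: the charge is `#W_t[dbl m]`, the cubes `E ⊆ dbl m`,
`#E = t` have base `dbl m ∖ E` of size `t − 1` and a common LOOP whenever the base lies under a common `t`-set, and the shadow bound. [this work] -/
theorem coeff_ladder_topRow_nonneg (h𝒳 : IsUpperSet (𝒳 : Set (Finset α))) (h𝒵 : IsUpperSet (𝒵 : Set (Finset α)))
    {t : ℕ} (ht : 1 ≤ t) (hXt : ∀ S ∈ 𝒳, t ≤ #S) (hZt : ∀ S ∈ 𝒵, t ≤ #S) {m : α →₀ ℕ} (hm : ∀ i, m i ≤ 2)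
    (hD : #(dbl m) = 2 * t - 1) :
    0 ≤ (ee t * (PiP * gf (𝒳 ∩ 𝒵) - gf 𝒳 * gf 𝒵) -
      gf (bySize (· ≤ t - 1) : Finset (Finset α)) * gf (bySize (t ≤ ·) : Finset (Finset α)) *
        gf ((𝒳 ∩ 𝒵).filter fun S => #S = t)).coeff m := by
  rw [coeff_sub, sub_nonneg, coeff_chargeT_top ht hm hD _ (fun w hw => (mem_filter.1 hw).2)]
  refine le_trans ?_ (sum_le_coeff_ee_mul_harris h𝒳 h𝒵 t m (S := (dbl m).powersetCard t) fun E hE => ?_)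
  swap
  · obtain ⟨hED, hEt⟩ := mem_powersetCard.1 hE
    refine mem_filter.2 ⟨mem_filter.2 ⟨mem_powerset.2 (subset_univ _), hEt⟩, ?_⟩
    exact (SahiAllButC.ind_le_iff_subset_support _ _).2 (hED.trans (dbl_subset_support m))
  -- each cube E ⊆ D has κ ≥ [D \ E ∈ shadow]
  have hcube : ∀ E ∈ (dbl m).powersetCard t, (if dbl m \ E ∈ shadowT 𝒳 𝒵 (dbl m) t then (1 : ℤ) else 0) ≤
      (PiP * gf (𝒳 ∩ 𝒵) - gf 𝒳 * gf 𝒵).coeff (m - ind E) := fun E hE => by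
    obtain ⟨hED, hEt⟩ := mem_powersetCard.1 hE
    rw [coeff_harrisForm_eq_kap _ _ (sub_ind_le_two_of_le_two hm E), dbl_sub_ind_of_le_two hm, sgl_sub_ind_of_le_two hm]
    split_ifs with hsh
    · obtain ⟨_, u, hu, huX, huZ⟩ := mem_filter.1 hsh
      have huE : u ∈ E := by
        have := mem_sdiff.1 hu; by_contra h; exact this.2 (mem_sdiff.2 ⟨this.1, h⟩)
      have hBX : dbl m \ E ∉ 𝒳 := fun h => by
        have := hXt _ h; rw [card_sdiff_of_subset hED, hD, hEt] at this; omega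
      have hBZ : dbl m \ E ∉ 𝒵 := fun h => by
        have := hZt _ h; rw [card_sdiff_of_subset hED, hD, hEt] at this; omega
      exact one_le_kap_of_loop h𝒳 h𝒵 hBX hBZ (mem_union_left _ (mem_inter.2 ⟨hED huE, huE⟩)) huX huZ
    · refine kap_nonneg h𝒳 h𝒵 _ _ (disjoint_union_right.2 ⟨disjoint_sdiff_inter (dbl m) E, ?_⟩)
      refine Disjoint.mono sdiff_subset sdiff_subset ?_
      rw [dbl_eq_lev]; exact disjoint_filter.2 fun i _ h1 h2 => by omega
  refine le_trans ?_ (sum_le_sum hcube)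
  rw [sum_boole]
  -- the cubes with D \ E in the shadow are in bijection with the shadow
  have hbij : #(((dbl m).powersetCard t).filter fun E => dbl m \ E ∈ shadowT 𝒳 𝒵 (dbl m) t) = #(shadowT 𝒳 𝒵 (dbl m) t) := by
    refine card_bij' (fun E _ => dbl m \ E) (fun B _ => dbl m \ B) (fun E hE => (mem_filter.1 hE).2) (fun B hB => ?_)
      (fun E hE => ?_) (fun B hB => ?_)
    · obtain ⟨hB', hsh⟩ := mem_filter.1 hB
      obtain ⟨hBD, hBt⟩ := mem_powersetCard.1 hB'
      refine mem_filter.2 ⟨mem_powersetCard.2 ⟨sdiff_subset, by rw [card_sdiff_of_subset hBD, hD, hBt]; omega⟩, ?_⟩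
      rw [Finset.sdiff_sdiff_eq_self hBD]; exact hB
    · exact Finset.sdiff_sdiff_eq_self (mem_powersetCard.1 (mem_filter.1 hE).1).1
    · exact Finset.sdiff_sdiff_eq_self (mem_powersetCard.1 (mem_filter.1 hB).1).1
  rw [hbij]
  exact_mod_cast card_le_card_shadowT (𝒳 := 𝒳) (𝒵 := 𝒵) ht hD

/-- **The empty rows**: if `m ≤ 2` has at least `2t` doubled points then the charge vanishes and `[m] L_t = [m](e_t·H) ≥ 0`. [this work] -/
theorem coeff_ladder_manyDoubled_nonneg (h𝒳 : IsUpperSet (𝒳 : Set (Finset α))) (h𝒵 : IsUpperSet (𝒵 : Set (Finset α)))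
    {t : ℕ} (ht : 1 ≤ t) {m : α →₀ ℕ} (hm : ∀ i, m i ≤ 2) (hD : 2 * t ≤ #(dbl m)) :
    0 ≤ (ee t * (PiP * gf (𝒳 ∩ 𝒵) - gf 𝒳 * gf 𝒵) -
      gf (bySize (· ≤ t - 1) : Finset (Finset α)) * gf (bySize (t ≤ ·) : Finset (Finset α)) *
        gf ((𝒳 ∩ 𝒵).filter fun S => #S = t)).coeff m := by
  rw [coeff_sub, sub_nonneg, coeff_chargeT_eq_sum]
  have h0 : ∀ w ∈ ((𝒳 ∩ 𝒵).filter fun S => #S = t).filter (fun w => ind w ≤ m),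
      (gf (bySize (· ≤ t - 1) : Finset (Finset α)) * gf (bySize (t ≤ ·) : Finset (Finset α))).coeff (m - ind w) = 0 :=
    fun w hw => by
    have hwt : #w = t := (mem_filter.1 (mem_filter.1 hw).1).2
    rw [coeff_thetaT_mul_atLeastT_eq_cH ht (sub_ind_le_two_of_le_two hm w), dbl_sub_ind_of_le_two hm]
    have : t ≤ #(dbl m \ w) := by
      have h1 := card_sdiff_add_card_inter (dbl m) w
      have h2 : #(dbl m ∩ w) ≤ t := hwt ▸ card_le_card inter_subset_right
      omega
    rw [show t - #(dbl m \ w) = 0 from by omega]; unfold cH; simp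
  rw [sum_congr rfl h0, sum_const_zero, coeff_ee_mul]
  exact sum_nonneg fun E _ => coeff_harrisForm_nonneg_kap h𝒳 h𝒵 _

/-- If some exponent of `m` is `≥ 4`, both sides of `(L_t)` vanish at `m`. [this work] -/
theorem coeff_ladder_eq_zero_of_four_le {t : ℕ} {m : α →₀ ℕ} {i : α} (hi : 4 ≤ m i) :
    (ee t * (PiP * gf (𝒳 ∩ 𝒵) - gf 𝒳 * gf 𝒵) -
      gf (bySize (· ≤ t - 1) : Finset (Finset α)) * gf (bySize (t ≤ ·) : Finset (Finset α)) *
        gf ((𝒳 ∩ 𝒵).filter fun S => #S = t)).coeff m = 0 := by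
  have hres : ∀ w : Finset α, ¬ ∀ j, (m - ind w) j ≤ 2 := fun w h => by
    have := h i; rw [SahiAllButC.tsub_ind_apply] at this; split_ifs at this <;> omega
  rw [coeff_sub, coeff_chargeT_eq_sum, coeff_ee_mul, sum_eq_zero fun E _ => coeff_harrisForm_eq_zero _ _ (hres E),
    sum_eq_zero fun w _ => coeff_thetaT_mul_atLeastT_eq_zero t (hres w), sub_zero]

end TopRow

end Summit.CriticalPhenomena.PercolationContinuityZ3.Theorems.SahiCTCForms
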